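import Literature.Probability.RandomPlanarGeometry.HexSAWStripEpsWalks
import Literature.Probability.RandomPlanarGeometry.HexSAWStripSurfaceGrowth
import Literature.Probability.RandomPlanarGeometry.HexSAWStripSurfaceLimits
import HarnessLib

/-!
# Geometric tails of the three boundary classes of the strip `S_{T,L}` below the threshold
# (BBdGDCG 2014, proof of Proposition 9 — "walks of length at least `L`" and "its remainder of order `L` tends to `0`" —
# made quantitative: rate `θ` for every `θ > x_c ν_T(y)`)

Topic `Literature/Probability/RandomPlanarGeometry` (continues `HexSAWStripEpsWalks.lean` — `HV.epsWalks`, `HV.eps_anatomy`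
(an `ε`-walk of `S_{T,L}` visits `≥ L + 1` vertices), `HV.eps_exit_unique`; `HexSAWStripSurfaceGrowth.lean` — the strip chains
`HV.stripChains T n`, `HV.stripZL T n y = Z_{T,n}(y)`, the growth rate `HV.stripNu T y = ν_T(y)` with `HV.tendsto_stripZL_rpow`;
and `HexSAWStripSurfaceLimits.lean` — `HV.stripAyLim`, `HV.stripByLim`).  Source: N. R. Beaton, M. Bousquet-Mélou, J. de Gier,
H. Duminil-Copin, A. J. Guttmann, *The critical fugacity for surface adsorption of self-avoiding walks on the honeycomb lattice is
`1 + √2`*, Comm. Math. Phys. 326 (2014) 727–754, arXiv:1109.0358v5, proof of Proposition 9 (§4.3, p. 14 ll. 23–26): "Indeed,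
`E_{T,L}(x_c,y)` counts some self-avoiding walks of length at least `L`, starting from `a`, and confined to a `T`-strip. But the generating function of walks in the `T`-strip converges at
`(x_c,y)` for `y < y_T` (see Corollary 8), and thus its remainder of order `L` tends to `0` as `L` grows."; proof of Corollary 8 (p. 13
l. 20): "Now by definition of `ρ_T`, the series `C_T(x_c,y)` converges if `x_c < ρ_T(y)`".

## What is proved (namespace `Literature.Probability.RandomPlanarGeometry.SAW.HV`; `x_c = hexCriticalFugacity`, `T ≥ 1`)

* `sum_le_sum_Ico_stripZL` — the counting injection behind all three estimates: a set `W` of mid-edge walks of `S_{T,L'}`, each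
  visiting at least `N + 1` vertices and determined by its inner vertex list, weighs at most `Σ_{N ≤ n < |V(S_{T,L'})|} x_c^{n+1} Z_{T,n}(y)`;
* `two_mul_fst_getElem_bounds` — along a walk from `a` the column `x₀` advances by at most one every TWO steps, so an `ε`-walk of
  `S_{T,L}` visits `≥ 2L + 2` vertices (the tree's `eps_anatomy` records `≥ L + 1`);
* **`stripGFy_eps_le_sum_Ico_stripZL`** — `E_{T,L}(x_c; y) ≤ Σ_{2L+1 ≤ n < |V(S_{T,L})|} x_c^{n+1} Z_{T,n}(y)` (the printed sentence);
  **`stripGFy_alpha_sub_le_sum_Ico_stripZL`**, **`stripGFy_beta_sub_le_sum_Ico_stripZL`** — for `L ≤ L'`,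
  `A_{T,L'}(x_c;y) − A_{T,L}(x_c;y)` and `B_{T,L'}(x_c;y) − B_{T,L}(x_c;y)` obey the same bound (an arch/bridge of `S_{T,L'}` that is
  not one of `S_{T,L}` leaves `S_{T,L}` laterally, hence visits `≥ 2L + 2` vertices);
* **`exists_sum_Ico_stripZL_le_geometric`** — if `x_c ν_T(y) < θ < 1` then `Σ_{L ≤ n < M} x_c^{n+1} Z_{T,n}(y) ≤ C θ^L` for all `L, M`
  (`Z_{T,n}(y)^{1/n} → ν_T(y)`);
* the GEOMETRIC TAILS: **`exists_stripGFy_eps_le_geometric`** (`E_{T,L}(x_c;y) ≤ C θ^{2L+1}`), **`exists_stripGFy_alpha_sub_le_geometric`**,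
  **`exists_stripGFy_beta_sub_le_geometric`** (`A_{T,L'} − A_{T,L}, B_{T,L'} − B_{T,L} ≤ C θ^{2L+1}` for `L ≤ L'`), the boundedness
  `bddAbove_stripGFy_alpha_of_stripNu_lt` / `bddAbove_stripGFy_beta_of_stripNu_lt`, and for the limits
  `A_T(x_c;y) = sup_L A_{T,L}`, `B_T(x_c;y) = sup_L B_{T,L}`: **`exists_stripAyLim_sub_le_geometric`**, **`exists_stripByLim_sub_le_geometric`**
  (`0 ≤ A_T − A_{T,L} ≤ C θ^{2L+1}`, `0 ≤ B_T − B_{T,L} ≤ C θ^{2L+1}`) — every `θ ∈ (x_c ν_T(y), 1)` is an admissible rate PER STEP,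
  i.e. `θ²` per column (two steps per column, `two_mul_fst_getElem_bounds`).  At `T = 1` the exponent is sharp: the tree's closed
  form `E_{1,L} = 2 q^{L+1}` (`q = x_c² y`, `HexSAWStripSurfaceWidthOneProfile`) decays at rate `q` per column, and `q ≤ (x_c ν_1(y))²`
  by the tree's `√y ≤ ν_T(y)` (`sqrt_le_stripNu`); that the admissible rates come arbitrarily close to `q`, i.e. `ν_1(y) = √y` on the
  zigzag `S_1`, is lane arithmetic not formalised here.

The hypothesis `x_c ν_T(y) < 1` is the printed `x_c < ρ_T(y)` (`ρ_T = 1/μ_T`); by the lane's threshold files it is equivalent to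
`y < y_T` (`HexSAWStripSurfaceGrowthBounds`: `ν_T(y) < x_c⁻¹ ⇒ y ∈ stripBddSet T`; the converse direction is the threshold
identification `ν_T(y_T) = x_c⁻¹`).  Label: the printed mechanism of Proposition 9 with the (implicit) geometric rate made explicit;
the lane's companion files give EXPLICIT contraction factors on `(0, y*]` only (`y* = 1 + √2`), this file covers the whole
sub-threshold range with the non-explicit rate `x_c ν_T(y)`.  Lane «pcv-sawmu», a-p2 g15.  EDITIONS: ed.2 = ed.1 (e6eb07be) code
verbatim, docstring locators per lit-1 g20 token CT-1 (verbatim quotations, p. 13 l. 20 / p. 4 l. 12 / DCS12 v2 p. 6); ed.3 = the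
two-steps-per-column sharpening (`L ↦ 2L + 1` in every bound; new `adj_fst_step`, `two_mul_fst_getElem_bounds`, `length_ge_of_mem_of_fst_eq`);
ed.4 = ed.3 code verbatim, the `T = 1` sharpness sentence re-worded per ref g53 §91.28 (the tree has `√y ≤ ν_T(y)` only).
-/

noncomputable section

open Finset Filter Topology Literature.Probability.LatticeModels Literature.Probability.Percolation SimpleGraph

namespace Literature.Probability.RandomPlanarGeometry.SAW.HV

/-! ### Lateral coordinate along a walk from `O` -/

section Lateral

/-- One step of `ℍ` in coordinates: the type bit flips; from a type-`0` vertex the column `x₀` stays or decreases by one, from a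
type-`1` vertex it stays or increases by one. [cite: DuminilCopinSmirnov2012, §3 (the lattice ℍ and the strip S_{T,L})] -/
theorem adj_fst_step {u v : HV} (h : hvGraph.Adj u v) :
    v.2.2 = !u.2.2 ∧ (u.2.2 = false → v.1 ≤ u.1 ∧ u.1 - 1 ≤ v.1) ∧ (u.2.2 = true → u.1 ≤ v.1 ∧ v.1 ≤ u.1 + 1) := by
  obtain ⟨a, b, c⟩ := u
  obtain ⟨a', b', c'⟩ := v
  cases c <;> cases c' <;> simp [hvGraph_adj, AdjRel] at h ⊢ <;> omega

/-- **Two steps per column.** In a chain of `ℍ` starting at `O` (type `0`, column `0`), the `i`-th vertex has type `i mod 2` and column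
`x₀` with `−(i + i mod 2) ≤ 2 x₀ ≤ i − i mod 2`: the column advances by at most one every two steps.
[cite: BeatonBousquetMelouDeGierDuminilCopinGuttmann2014, proof of Proposition 9 (§4.3, arXiv v5 p. 14: walks reaching the cut have length at least L); lane: sharp two-step form] -/
theorem two_mul_fst_getElem_bounds {l : List HV} (hc : l.IsChain hvGraph.Adj) (hh : l.head? = some hvOrigin) :
    ∀ (i : ℕ) (hi : i < l.length), (l[i]).2.2 = decide (i % 2 = 1) ∧
      2 * (l[i]).1 ≤ (i : ℤ) - (i % 2 : ℕ) ∧ -((i : ℤ) + (i % 2 : ℕ)) ≤ 2 * (l[i]).1 := by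
  intro i
  induction i with
  | zero =>
    intro hi
    cases l with
    | nil => simp at hi
    | cons a l => simp only [List.head?_cons, Option.some.injEq] at hh; subst hh; simp [hvOrigin]
  | succ i ih =>
    intro hi
    obtain ⟨ht, h1, h2⟩ := ih (by omega)
    obtain ⟨hflip, hf, htr⟩ := adj_fst_step (hc.getElem i hi)
    have hmod : (i + 1) % 2 = 1 - i % 2 := by omega
    refine ⟨?_, ?_, ?_⟩
    · rw [hflip, ht]
      rcases Nat.mod_two_eq_zero_or_one i with h0 | h0 <;> simp [h0, hmod]
    · rcases Nat.mod_two_eq_zero_or_one i with h0 | h0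
      · have hb : (l[i]).2.2 = false := by rw [ht, h0]; rfl
        have := (hf hb).1
        rw [hmod, h0]; rw [h0] at h1; push_cast at h1 ⊢; omega
      · have hb : (l[i]).2.2 = true := by rw [ht, h0]; rfl
        have := (htr hb).2
        rw [hmod, h0]; rw [h0] at h1; push_cast at h1 ⊢; omega
    · rcases Nat.mod_two_eq_zero_or_one i with h0 | h0
      · have hb : (l[i]).2.2 = false := by rw [ht, h0]; rfl
        have := (hf hb).2
        rw [hmod, h0]; rw [h0] at h2; push_cast at h2 ⊢; omega
      · have hb : (l[i]).2.2 = true := by rw [ht, h0]; rfl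
        have := (htr hb).1
        rw [hmod, h0]; rw [h0] at h2; push_cast at h2 ⊢; omega

/-- A chain of `ℍ` from `O` containing a vertex `v` with `|x₀(v)| ≥ L + 1` has at least `2L + 2` vertices.
[cite: BeatonBousquetMelouDeGierDuminilCopinGuttmann2014, proof of Proposition 9 (§4.3, arXiv v5 p. 14)] -/
theorem length_ge_of_mem_of_abs_fst {l : List HV} (hc : l.IsChain hvGraph.Adj) (hh : l.head? = some hvOrigin)
    {v : HV} (hv : v ∈ l) {L : ℕ} (hL : (L : ℤ) + 1 ≤ |v.1|) : 2 * L + 2 ≤ l.length := by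
  obtain ⟨i, hi, rfl⟩ := List.getElem_of_mem hv
  obtain ⟨-, h1, h2⟩ := two_mul_fst_getElem_bounds hc hh i hi
  have hm : (i % 2 : ℕ) ≤ 1 := Nat.lt_succ_iff.1 (Nat.mod_lt i two_pos)
  rcases le_abs'.1 hL with h | h
  · have : (2 : ℤ) * L + 1 ≤ i := by push_cast at h2; omega
    omega
  · have : (2 : ℤ) * L + 2 ≤ i := by push_cast at h1; omega
    omega

/-- A chain of `ℍ` from `O` whose vertex `v` of type `1` sits on the column `x₀ = L` has at least `2L + 2` vertices.
[cite: BeatonBousquetMelouDeGierDuminilCopinGuttmann2014, proof of Proposition 9 (§4.3, arXiv v5 p. 14)] -/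
theorem length_ge_of_mem_of_fst_eq {l : List HV} (hc : l.IsChain hvGraph.Adj) (hh : l.head? = some hvOrigin)
    {v : HV} (hv : v ∈ l) (hb : v.2.2 = true) {L : ℕ} (hL : v.1 = L) : 2 * L + 2 ≤ l.length := by
  obtain ⟨i, hi, rfl⟩ := List.getElem_of_mem hv
  obtain ⟨ht, h1, -⟩ := two_mul_fst_getElem_bounds hc hh i hi
  have hodd : i % 2 = 1 := by
    by_contra h0
    have h0' : i % 2 = 0 := by omega
    rw [h0'] at ht; simp at ht; rw [ht] at hb; exact Bool.false_ne_true hb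
  have : (2 : ℤ) * L + 1 ≤ i := by rw [hodd] at h1; push_cast at h1; omega
  omega

end Lateral

/-! ### The counting injection: long walks of `S_{T,L'}` weigh at most a tail of `Σ_n x_c^{n+1} Z_{T,n}(y)` -/

section Counting

variable {T : ℕ}

/-- `surfContacts T P = topCnt T (inner P)`. [cite: BeatonBousquetMelouDeGierDuminilCopinGuttmann2014, §2 (arXiv v5 p. 4 l. 12: c(γ), the number of contacts with the surface)] -/
theorem surfContacts_eq_topCnt_inner (T : ℕ) (P : List HV) : surfContacts T P = topCnt T (inner P) := rfl

/-- The inner list of a non-trivial mid-edge walk of `S_{T,L'}` with `n + 1` vertices is a strip chain of `S_T` with `n` steps.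
[cite: MadrasSlade1993, §8.2, eq. (8.2.1) (walks of a tube up to translation); DuminilCopinSmirnov2012, §3] -/
theorem inner_mem_stripChains {L' : ℕ} {P : List HV} (hP : P ∈ midWalks (stripV T L')) (hlen : 1 ≤ mwLen P) :
    inner P ∈ stripChains T (mwLen P - 1) ∧ mwLen P ≤ (stripV T L').card := by
  rw [mem_midWalks_iff] at hP
  have hcard := hP.mwLen_le_card
  rcases hP.trivial_or_exists with rfl | ⟨l, u, hl, rfl⟩
  · simp at hlen
  obtain ⟨hc, hh, -, hV, hnd, -⟩ := (isMidWalk_cons_append_iff _ hl _).1 hP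
  refine ⟨?_, hcard⟩
  rw [inner_cons_append, mwLen_cons_append]
  refine mem_stripChains_iff.2 ⟨hc, hnd, ?_, ⟨hvOrigin, hh, rfl⟩, fun v hv => lev_mem_of_mem_stripV (hV v hv)⟩
  have : 0 < l.length := List.length_pos_of_ne_nil hl
  omega

/-- Strip chains of different lengths are disjoint (the tree's `disjoint_stripChains` of `HexSAWStripSurfaceGrowthBounds`,
copied `private` so that this file does not depend on that module). [cite: MadrasSlade1993, §8.2, eq. (8.2.1) (walks of a tube up to translation)] -/
private theorem disjoint_stripChains_of_ne (T : ℕ) {n n' : ℕ} (h : n ≠ n') :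
    Disjoint (stripChains T n) (stripChains T n') := by
  rw [Finset.disjoint_left]
  intro l hl hl'
  exact h (by have := (mem_stripChains_iff.1 hl).2.2.1; have := (mem_stripChains_iff.1 hl').2.2.1; omega)

/-- **Counting injection.** Let `W` be a set of mid-edge walks of `S_{T,L'}`, each visiting at least `L + 1` vertices, on which
`inner` is injective.  Then `Σ_{γ ∈ W} x_c^{ℓ(γ)} y^{c(γ)} ≤ Σ_{L ≤ n < |V(S_{T,L'})|} x_c^{n+1} Z_{T,n}(y)`.
[cite: BeatonBousquetMelouDeGierDuminilCopinGuttmann2014, proof of Proposition 9 (§4.3, arXiv v5 p. 14: "E_{T,L}(x_c;y) counts some self-avoiding walks of length at least L")] -/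
theorem sum_le_sum_Ico_stripZL {L L' : ℕ} {y : ℝ} (hy : 0 ≤ y) (W : Finset (List HV))
    (hW : W ⊆ midWalks (stripV T L')) (hinj : Set.InjOn inner (W : Set (List HV)))
    (hlen : ∀ P ∈ W, L + 1 ≤ mwLen P) :
    ∑ P ∈ W, hexCriticalFugacity ^ mwLen P * y ^ surfContacts T P ≤
      ∑ n ∈ Ico L (stripV T L').card, hexCriticalFugacity ^ (n + 1) * stripZL T n y := by
  have hx := hexCriticalFugacity_pos_lt_one.1
  -- rewrite the left-hand side over the inner lists
  have hlhs : ∑ P ∈ W, hexCriticalFugacity ^ mwLen P * y ^ surfContacts T P =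
      ∑ l ∈ W.image inner, hexCriticalFugacity ^ l.length * y ^ topCnt T l := by
    rw [sum_image hinj]
    refine sum_congr rfl fun P hP => ?_
    rw [surfContacts_eq_topCnt_inner, (mem_midWalks_iff.1 (hW hP)).length_inner]
  rw [hlhs]
  -- the image lies in the union of the strip chains of lengths in `Ico L |V|`
  have hsub : W.image inner ⊆ (Ico L (stripV T L').card).biUnion (stripChains T) := by
    intro l hl
    rw [mem_image] at hl
    obtain ⟨P, hP, rfl⟩ := hl
    have h1 := hlen P hP
    obtain ⟨hmem, hcard⟩ := inner_mem_stripChains (hW hP) (by omega)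
    exact mem_biUnion.2 ⟨mwLen P - 1, mem_Ico.2 ⟨by omega, by omega⟩, hmem⟩
  calc ∑ l ∈ W.image inner, hexCriticalFugacity ^ l.length * y ^ topCnt T l
      ≤ ∑ l ∈ (Ico L (stripV T L').card).biUnion (stripChains T), hexCriticalFugacity ^ l.length * y ^ topCnt T l :=
        sum_le_sum_of_subset_of_nonneg hsub fun _ _ _ => by positivity
    _ = ∑ n ∈ Ico L (stripV T L').card, ∑ l ∈ stripChains T n, hexCriticalFugacity ^ l.length * y ^ topCnt T l :=
        sum_biUnion fun n _ n' _ hnn => disjoint_stripChains_of_ne T hnn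
    _ = ∑ n ∈ Ico L (stripV T L').card, hexCriticalFugacity ^ (n + 1) * stripZL T n y := by
        refine sum_congr rfl fun n _ => ?_
        rw [stripZL, mul_sum]
        refine sum_congr rfl fun l hl => ?_
        rw [(mem_stripChains_iff.1 hl).2.2.1]

/-! ### Exit uniqueness and injectivity of `inner` on a boundary class -/

/-- The exit vertex of a walk `a → α` is determined by its last inner vertex. [cite: DuminilCopinSmirnov2012, §3 (the boundary arc α)] -/
theorem alpha_exit_unique {z u u' : HV} (h : IsAlphaDart (z, u)) (h' : IsAlphaDart (z, u')) : u = u' :=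
  h.2.2.trans h'.2.2.symm

/-- The exit vertex of a walk `a → β` is determined by its last inner vertex. [cite: DuminilCopinSmirnov2012, §3 (the boundary arc β)] -/
theorem beta_exit_unique {z u u' : HV} (h : IsBetaDart T (z, u)) (h' : IsBetaDart T (z, u')) : u = u' :=
  h.2.2.trans h'.2.2.symm

/-- On the non-trivial walks of a boundary class whose exit vertex is determined by the last inner vertex, `inner` is injective.
[cite: DuminilCopinSmirnov2012, §3 (walks a → z classified by the boundary arc of z)] -/
theorem injOn_inner_of_exit_unique {L' : ℕ} (cls : HV × HV → Prop) [DecidablePred cls]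
    (huniq : ∀ z u u' : HV, 0 ≤ z.2.1 → cls (z, u) → cls (z, u') → u = u')
    (W : Finset (List HV)) (hW : W ⊆ (midWalks (stripV T L')).filter fun P => cls (finalDart P))
    (hnt : ∀ P ∈ W, 1 ≤ mwLen P) : Set.InjOn inner (W : Set (List HV)) := by
  intro P hP P' hP' heq
  rw [mem_coe] at hP hP'
  have h1 := hnt P hP
  have h1' := hnt P' hP'
  have hm := hW hP
  have hm' := hW hP'
  rw [mem_filter, mem_midWalks_iff] at hm hm'
  rcases hm.1.trivial_or_exists with rfl | ⟨l, u, hl, rfl⟩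
  · simp at h1
  rcases hm'.1.trivial_or_exists with h0 | ⟨l', u', hl', h0⟩
  · subst h0; simp at h1'
  subst h0
  simp only [inner_cons_append] at heq
  subst heq
  rw [finalDart_cons_append hl] at hm
  rw [finalDart_cons_append hl'] at hm'
  obtain ⟨-, -, -, hV, -, -⟩ := (isMidWalk_cons_append_iff _ hl _).1 hm.1
  have hz : 0 ≤ (l.getLast hl).2.1 := (mem_stripV_iff.1 (hV _ (List.getLast_mem hl))).1
  rw [huniq _ _ _ hz hm.2 hm'.2]

/-! ### The three classes: `E_{T,L}`, and the increments of `A_{T,·}`, `B_{T,·}` beyond `S_{T,L}` -/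

/-- **`E_{T,L}(x_c; y) ≤ Σ_{2L+1 ≤ n < |V(S_{T,L})|} x_c^{n+1} Z_{T,n}(y)`** (`y ≥ 0`): an `ε`-walk visits at least `2L + 2` vertices and is
determined by its inner list, a strip chain. [cite: BeatonBousquetMelouDeGierDuminilCopinGuttmann2014, proof of Proposition 9 (§4.3, arXiv v5 p. 14: "E_{T,L}(x_c;y) counts some self-avoiding walks of length at least L")] -/
theorem stripGFy_eps_le_sum_Ico_stripZL (L : ℕ) {y : ℝ} (hy : 0 ≤ y) :
    stripGFy T L (IsEpsDart L) y ≤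
      ∑ n ∈ Ico (2 * L + 1) (stripV T L).card, hexCriticalFugacity ^ (n + 1) * stripZL T n y := by
  rw [stripGFy_eps_eq]
  have hlen : ∀ P ∈ epsWalks T L, 2 * L + 1 + 1 ≤ mwLen P := by
    intro P hP
    obtain ⟨l, u, hl, rfl, hc, hh, -, hV, hε, -⟩ := eps_anatomy hP
    rw [mwLen_cons_append]
    have hv := List.getLast_mem hl
    obtain ⟨hb, hx⟩ := hε
    dsimp only at hb hx
    rcases hx with ⟨h1, -⟩ | ⟨h1, -⟩
    · have h0 : 0 ≤ (l.getLast hl).2.1 := (mem_stripV_iff.1 (hV _ hv)).1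
      refine length_ge_of_mem_of_abs_fst hc hh hv ?_
      calc (L : ℤ) + 1 ≤ -(l.getLast hl).1 := by omega
        _ ≤ |(l.getLast hl).1| := neg_le_abs _
    · exact length_ge_of_mem_of_fst_eq hc hh hv hb h1
  refine sum_le_sum_Ico_stripZL hy (epsWalks T L) (filter_subset _ _) ?_ hlen
  refine injOn_inner_of_exit_unique (IsEpsDart L) (fun z u u' hz h h' => eps_exit_unique hz h h') _
    (fun P hP => hP) fun P hP => ?_
  have := hlen P hP; omega

/-- A walk of `S_{T,L'}` of a boundary class `cls` not depending on `L` that is NOT a walk of `S_{T,L}` visits at least `L + 2`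
vertices — in fact `2L + 2` (one of them lies laterally beyond the cuts of `S_{T,L}`, two steps per column).
[cite: BeatonBousquetMelouDeGierDuminilCopinGuttmann2014, proof of Proposition 9 (§4.3, arXiv v5 p. 14); DuminilCopinSmirnov2012, §3 (S_{T,L} ⊂ S_{T,L'})] -/
theorem le_mwLen_of_mem_sdiff {L L' : ℕ} (cls : HV × HV → Prop) [DecidablePred cls] {P : List HV}
    (hP : P ∈ ((midWalks (stripV T L')).filter fun P => cls (finalDart P)) \
      ((midWalks (stripV T L)).filter fun P => cls (finalDart P))) :
    2 * L + 2 ≤ mwLen P := by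
  obtain ⟨hP1, hP2⟩ := Finset.mem_sdiff.1 hP
  obtain ⟨hmw, hcls⟩ := Finset.mem_filter.1 hP1
  rw [mem_midWalks_iff] at hmw
  have hnot : ¬ IsMidWalk (stripV T L) P := fun h => hP2 (Finset.mem_filter.2 ⟨mem_midWalks_iff.2 h, hcls⟩)
  -- some inner vertex lies outside `S_{T,L}`
  have hex : ∃ v ∈ inner P, v ∉ stripV T L := by
    by_contra hall
    push Not at hall
    exact hnot ⟨hmw.1, hmw.2.1, hmw.2.2.1, hall, hmw.2.2.2.2.1, hmw.2.2.2.2.2⟩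
  obtain ⟨v, hv, hvL⟩ := hex
  have hvL' := hmw.2.2.2.1 v hv
  rcases hmw.trivial_or_exists with rfl | ⟨l, u, hl, rfl⟩
  · simp [inner] at hv
  obtain ⟨hc, hh, -, -, -, -⟩ := (isMidWalk_cons_append_iff _ hl _).1 hmw
  rw [inner_cons_append] at hv
  rw [mwLen_cons_append]
  refine length_ge_of_mem_of_abs_fst hc hh hv ?_
  rw [mem_stripV_iff] at hvL'
  rw [mem_stripV_iff, not_and, not_and, not_and_or] at hvL
  have hb : 0 ≤ bit v ∧ bit v ≤ 1 := by unfold bit; split_ifs <;> simp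
  rcases hvL hvL'.1 hvL'.2.1 with h | h
  · rw [not_le] at h
    have : v.1 ≤ -((L : ℤ) + 1) := by omega
    calc (L : ℤ) + 1 ≤ -v.1 := by omega
      _ ≤ |v.1| := neg_le_abs v.1
  · rw [not_le] at h
    exact le_trans (by omega) (le_abs_self v.1)

/-- The class generating function of `S_{T,L'}` minus that of `S_{T,L}` (`L ≤ L'`, a class not depending on `L`) is the sum over
the walks of `S_{T,L'}` leaving `S_{T,L}`. [cite: DuminilCopinSmirnov2012, §3 (arXiv v2 p. 6 ll. 61–63: "sequences (A^x_{T,L})_{L>0} and (B^x_{T,L})_{L>0} are increasing in L and are bounded")] -/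
theorem stripGFy_sub_eq_sum_sdiff {L L' : ℕ} (h : L ≤ L') (cls : HV × HV → Prop) [DecidablePred cls] (y : ℝ) :
    stripGFy T L' cls y - stripGFy T L cls y =
      ∑ P ∈ ((midWalks (stripV T L')).filter fun P => cls (finalDart P)) \
        ((midWalks (stripV T L)).filter fun P => cls (finalDart P)), hexCriticalFugacity ^ mwLen P * y ^ surfContacts T P := by
  rw [stripGFy, stripGFy, ← sum_sdiff_eq_sub]
  exact filter_subset_filter _ (midWalks_mono (stripV_mono_L h))

/-- **`A_{T,L'}(x_c;y) − A_{T,L}(x_c;y) ≤ Σ_{2L+1 ≤ n < |V(S_{T,L'})|} x_c^{n+1} Z_{T,n}(y)`** for `L ≤ L'`, `y ≥ 0`.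
[cite: BeatonBousquetMelouDeGierDuminilCopinGuttmann2014, proof of Proposition 9 (§4.3, arXiv v5 p. 14) and Corollary 8 (p. 12)] -/
theorem stripGFy_alpha_sub_le_sum_Ico_stripZL {L L' : ℕ} (h : L ≤ L') {y : ℝ} (hy : 0 ≤ y) :
    stripGFy T L' IsAlphaDart y - stripGFy T L IsAlphaDart y ≤
      ∑ n ∈ Ico (2 * L + 1) (stripV T L').card, hexCriticalFugacity ^ (n + 1) * stripZL T n y := by
  rw [stripGFy_sub_eq_sum_sdiff h]
  have hlen : ∀ P ∈ ((midWalks (stripV T L')).filter fun P => IsAlphaDart (finalDart P)) \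
      ((midWalks (stripV T L)).filter fun P => IsAlphaDart (finalDart P)), 2 * L + 1 + 1 ≤ mwLen P :=
    fun P hP => by have := le_mwLen_of_mem_sdiff IsAlphaDart hP; omega
  refine sum_le_sum_Ico_stripZL hy _ (fun P hP => (mem_filter.1 (mem_sdiff.1 hP).1).1) ?_ hlen
  exact injOn_inner_of_exit_unique IsAlphaDart (fun z u u' _ hzu hzu' => alpha_exit_unique hzu hzu') _
    (fun P hP => (mem_sdiff.1 hP).1) fun P hP => by have := hlen P hP; omega

/-- **`B_{T,L'}(x_c;y) − B_{T,L}(x_c;y) ≤ Σ_{2L+1 ≤ n < |V(S_{T,L'})|} x_c^{n+1} Z_{T,n}(y)`** for `L ≤ L'`, `y ≥ 0`.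
[cite: BeatonBousquetMelouDeGierDuminilCopinGuttmann2014, proof of Proposition 9 (§4.3, arXiv v5 p. 14) and Corollary 8 (p. 12)] -/
theorem stripGFy_beta_sub_le_sum_Ico_stripZL {L L' : ℕ} (h : L ≤ L') {y : ℝ} (hy : 0 ≤ y) :
    stripGFy T L' (IsBetaDart T) y - stripGFy T L (IsBetaDart T) y ≤
      ∑ n ∈ Ico (2 * L + 1) (stripV T L').card, hexCriticalFugacity ^ (n + 1) * stripZL T n y := by
  rw [stripGFy_sub_eq_sum_sdiff h]
  have hlen : ∀ P ∈ ((midWalks (stripV T L')).filter fun P => IsBetaDart T (finalDart P)) \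
      ((midWalks (stripV T L)).filter fun P => IsBetaDart T (finalDart P)), 2 * L + 1 + 1 ≤ mwLen P :=
    fun P hP => by have := le_mwLen_of_mem_sdiff (IsBetaDart T) hP; omega
  refine sum_le_sum_Ico_stripZL hy _ (fun P hP => (mem_filter.1 (mem_sdiff.1 hP).1).1) ?_ hlen
  exact injOn_inner_of_exit_unique (IsBetaDart T) (fun z u u' _ hzu hzu' => beta_exit_unique hzu hzu') _
    (fun P hP => (mem_sdiff.1 hP).1) fun P hP => by have := hlen P hP; omega

end Counting

/-! ### Geometric tails below the threshold: every `θ > x_c ν_T(y)` is a rate -/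

section Tails

variable {T : ℕ}

/-- If `x_c ν_T(y) < θ` then eventually `x_c^{n+1} Z_{T,n}(y) ≤ x_c θⁿ` (`Z_{T,n}(y)^{1/n} → ν_T(y)`).
[cite: BeatonBousquetMelouDeGierDuminilCopinGuttmann2014, proof of Corollary 8 (arXiv v5 p. 13 l. 20: "the series C_T(x_c,y) converges if x_c < ρ_T(y)")] -/
theorem eventually_pow_mul_stripZL_le (hT : 1 ≤ T) {y θ : ℝ} (hy : 0 < y) (hθ : hexCriticalFugacity * stripNu T y < θ) :
    ∀ᶠ n : ℕ in atTop, hexCriticalFugacity ^ (n + 1) * stripZL T n y ≤ hexCriticalFugacity * θ ^ n := by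
  have hx := hexCriticalFugacity_pos_lt_one.1
  set ρ := θ / hexCriticalFugacity with hρ
  have hνρ : stripNu T y < ρ := by
    rw [hρ, lt_div_iff₀ hx, mul_comm]; exact hθ
  have hρx : hexCriticalFugacity * ρ = θ := by rw [hρ]; field_simp
  have h1 := (tendsto_stripZL_rpow hT hy).eventually (gt_mem_nhds hνρ)
  filter_upwards [h1, eventually_ge_atTop 1] with n hn hn1
  have hZ0 : 0 ≤ stripZL T n y := stripZL_nonneg T n hy.le
  have hpow : stripZL T n y ≤ ρ ^ n := by
    have h2 : ((stripZL T n y) ^ (1 / (n : ℝ))) ^ (n : ℝ) ≤ ρ ^ (n : ℝ) :=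
      Real.rpow_le_rpow (Real.rpow_nonneg hZ0 _) hn.le (Nat.cast_nonneg n)
    rw [← Real.rpow_mul hZ0, one_div_mul_cancel (by positivity), Real.rpow_one, Real.rpow_natCast] at h2
    exact h2
  calc hexCriticalFugacity ^ (n + 1) * stripZL T n y = hexCriticalFugacity * (hexCriticalFugacity ^ n * stripZL T n y) := by ring
    _ ≤ hexCriticalFugacity * (hexCriticalFugacity ^ n * ρ ^ n) :=
        mul_le_mul_of_nonneg_left (mul_le_mul_of_nonneg_left hpow (pow_nonneg hx.le n)) hx.le
    _ = hexCriticalFugacity * θ ^ n := by rw [← mul_pow, hρx]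

/-- **Geometric tail of the strip series.** If `x_c ν_T(y) < θ < 1` (`y > 0`) there is `C > 0` with
`Σ_{L ≤ n < M} x_c^{n+1} Z_{T,n}(y) ≤ C θ^L` for all `L, M`.
[cite: BeatonBousquetMelouDeGierDuminilCopinGuttmann2014, Corollary 8 (arXiv v5 p. 12) and proof of Proposition 9 (p. 14 l. 26: "its remainder of order L tends to 0 as L grows")] -/
theorem exists_sum_Ico_stripZL_le_geometric (hT : 1 ≤ T) {y θ : ℝ} (hy : 0 < y)
    (hθ : hexCriticalFugacity * stripNu T y < θ) (hθ1 : θ < 1) :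
    ∃ C : ℝ, 0 < C ∧ ∀ L M : ℕ,
      ∑ n ∈ Ico L M, hexCriticalFugacity ^ (n + 1) * stripZL T n y ≤ C * θ ^ L := by
  have hx := hexCriticalFugacity_pos_lt_one.1
  have hθ0 : 0 < θ := lt_trans (mul_pos hx (stripNu_pos hT hy)) hθ
  obtain ⟨n₀, hn₀⟩ := eventually_atTop.1 (eventually_pow_mul_stripZL_le hT hy hθ)
  set f : ℕ → ℝ := fun n => hexCriticalFugacity ^ (n + 1) * stripZL T n y with hf
  have hf0 : ∀ n, 0 ≤ f n := fun n => mul_nonneg (pow_nonneg hx.le _) (stripZL_nonneg T n hy.le)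
  set S₀ : ℝ := ∑ n ∈ range n₀, f n with hS₀
  have hS₀0 : 0 ≤ S₀ := sum_nonneg fun n _ => hf0 n
  refine ⟨S₀ / θ ^ n₀ + hexCriticalFugacity / (1 - θ), by positivity, fun L M => ?_⟩
  -- pointwise: f n ≤ [n < n₀] f n + x_c θⁿ
  have hpt : ∀ n, f n ≤ (if n < n₀ then f n else 0) + hexCriticalFugacity * θ ^ n := by
    intro n
    split_ifs with h
    · linarith [mul_nonneg hx.le (pow_nonneg hθ0.le n)]
    · rw [zero_add]; exact hn₀ n (not_lt.1 h)
  have h1 : ∑ n ∈ Ico L M, f n ≤ ∑ n ∈ Ico L M, ((if n < n₀ then f n else 0) + hexCriticalFugacity * θ ^ n) :=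
    sum_le_sum fun n _ => hpt n
  rw [sum_add_distrib, ← mul_sum] at h1
  -- the finitely many early terms
  have h2 : ∑ n ∈ Ico L M, (if n < n₀ then f n else 0) ≤ S₀ / θ ^ n₀ * θ ^ L := by
    by_cases hL : n₀ ≤ L
    · have : ∑ n ∈ Ico L M, (if n < n₀ then f n else 0) = 0 :=
        sum_eq_zero fun n hn => by rw [if_neg]; have := (mem_Ico.1 hn).1; omega
      rw [this]; positivity
    · push Not at hL
      calc ∑ n ∈ Ico L M, (if n < n₀ then f n else 0) ≤ ∑ n ∈ Ico L M, (if n ∈ range n₀ then f n else 0) :=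
            sum_le_sum fun n _ => by simp only [mem_range]; exact le_rfl
        _ ≤ ∑ n ∈ range n₀, f n := by
            rw [← sum_filter]
            refine sum_le_sum_of_subset_of_nonneg (fun n hn => (mem_filter.1 hn).2) fun n _ _ => hf0 n
        _ = S₀ / θ ^ n₀ * θ ^ n₀ := by rw [hS₀, div_mul_cancel₀ _ (pow_ne_zero _ hθ0.ne')]
        _ ≤ S₀ / θ ^ n₀ * θ ^ L :=
            mul_le_mul_of_nonneg_left (pow_le_pow_of_le_one hθ0.le hθ1.le hL.le) (by positivity)
  -- the geometric part
  have h3 : hexCriticalFugacity * ∑ n ∈ Ico L M, θ ^ n ≤ hexCriticalFugacity / (1 - θ) * θ ^ L := by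
    have := geom_sum_Ico_le_of_lt_one hθ0.le hθ1 (m := L) (n := M)
    calc hexCriticalFugacity * ∑ n ∈ Ico L M, θ ^ n ≤ hexCriticalFugacity * (θ ^ L / (1 - θ)) :=
          mul_le_mul_of_nonneg_left this hx.le
      _ = hexCriticalFugacity / (1 - θ) * θ ^ L := by ring
  calc ∑ n ∈ Ico L M, f n ≤ _ := h1
    _ ≤ S₀ / θ ^ n₀ * θ ^ L + hexCriticalFugacity / (1 - θ) * θ ^ L := add_le_add h2 h3
    _ = (S₀ / θ ^ n₀ + hexCriticalFugacity / (1 - θ)) * θ ^ L := by ring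

/-- **Geometric decay of the side class**: if `x_c ν_T(y) < θ < 1` then `E_{T,L}(x_c; y) ≤ C θ^{2L+1}` for all `L`.
[cite: BeatonBousquetMelouDeGierDuminilCopinGuttmann2014, proof of Proposition 9 (§4.3, arXiv v5 p. 14: "E_{T,L}(x_c;y) … tends to 0 as L → ∞")] -/
theorem exists_stripGFy_eps_le_geometric (hT : 1 ≤ T) {y θ : ℝ} (hy : 0 < y)
    (hθ : hexCriticalFugacity * stripNu T y < θ) (hθ1 : θ < 1) :
    ∃ C : ℝ, 0 < C ∧ ∀ L : ℕ, stripGFy T L (IsEpsDart L) y ≤ C * θ ^ (2 * L + 1) := by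
  obtain ⟨C, hC, h⟩ := exists_sum_Ico_stripZL_le_geometric hT hy hθ hθ1
  exact ⟨C, hC, fun L => (stripGFy_eps_le_sum_Ico_stripZL L hy.le).trans (h _ _)⟩

/-- **Geometric convergence of the arch class**: if `x_c ν_T(y) < θ < 1` then `A_{T,L'}(x_c;y) − A_{T,L}(x_c;y) ≤ C θ^{2L+1}` for all
`L ≤ L'`. [cite: BeatonBousquetMelouDeGierDuminilCopinGuttmann2014, Corollary 8 and proof of Proposition 9 (arXiv v5 pp. 12, 14)] -/
theorem exists_stripGFy_alpha_sub_le_geometric (hT : 1 ≤ T) {y θ : ℝ} (hy : 0 < y)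
    (hθ : hexCriticalFugacity * stripNu T y < θ) (hθ1 : θ < 1) :
    ∃ C : ℝ, 0 < C ∧ ∀ L L' : ℕ, L ≤ L' →
      stripGFy T L' IsAlphaDart y - stripGFy T L IsAlphaDart y ≤ C * θ ^ (2 * L + 1) := by
  obtain ⟨C, hC, h⟩ := exists_sum_Ico_stripZL_le_geometric hT hy hθ hθ1
  exact ⟨C, hC, fun L L' hLL' => (stripGFy_alpha_sub_le_sum_Ico_stripZL hLL' hy.le).trans (h _ _)⟩

/-- **Geometric convergence of the bridge class**: if `x_c ν_T(y) < θ < 1` then `B_{T,L'}(x_c;y) − B_{T,L}(x_c;y) ≤ C θ^{2L+1}` for all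
`L ≤ L'`. [cite: BeatonBousquetMelouDeGierDuminilCopinGuttmann2014, Corollary 8 and proof of Proposition 9 (arXiv v5 pp. 12, 14)] -/
theorem exists_stripGFy_beta_sub_le_geometric (hT : 1 ≤ T) {y θ : ℝ} (hy : 0 < y)
    (hθ : hexCriticalFugacity * stripNu T y < θ) (hθ1 : θ < 1) :
    ∃ C : ℝ, 0 < C ∧ ∀ L L' : ℕ, L ≤ L' →
      stripGFy T L' (IsBetaDart T) y - stripGFy T L (IsBetaDart T) y ≤ C * θ ^ (2 * L + 1) := by
  obtain ⟨C, hC, h⟩ := exists_sum_Ico_stripZL_le_geometric hT hy hθ hθ1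
  exact ⟨C, hC, fun L L' hLL' => (stripGFy_beta_sub_le_sum_Ico_stripZL hLL' hy.le).trans (h _ _)⟩

/-- A rate strictly between `x_c ν_T(y)` and `1` exists as soon as `ν_T(y) < x_c⁻¹`. [cite: BeatonBousquetMelouDeGierDuminilCopinGuttmann2014, Corollary 8 (arXiv v5 p. 12)] -/
theorem exists_rate_of_stripNu_lt {y : ℝ} (hν : stripNu T y < hexCriticalFugacity⁻¹) :
    ∃ θ : ℝ, hexCriticalFugacity * stripNu T y < θ ∧ θ < 1 := by
  have hx := hexCriticalFugacity_pos_lt_one.1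
  have h : hexCriticalFugacity * stripNu T y < 1 := by
    calc hexCriticalFugacity * stripNu T y < hexCriticalFugacity * hexCriticalFugacity⁻¹ := mul_lt_mul_of_pos_left hν hx
      _ = 1 := mul_inv_cancel₀ hx.ne'
  exact ⟨(hexCriticalFugacity * stripNu T y + 1) / 2, by linarith, by linarith⟩

/-- `ν_T(y) < x_c⁻¹ ⇒ (A_{T,L}(x_c;y))_L` is bounded. [cite: BeatonBousquetMelouDeGierDuminilCopinGuttmann2014, Corollary 8 (arXiv v5 p. 12; A_T(x_c, y) is finite below y_T)] -/
theorem bddAbove_stripGFy_alpha_of_stripNu_lt (hT : 1 ≤ T) {y : ℝ} (hy : 0 < y) (hν : stripNu T y < hexCriticalFugacity⁻¹) :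
    BddAbove (Set.range fun L : ℕ => stripGFy T L IsAlphaDart y) := by
  obtain ⟨θ, hθ, hθ1⟩ := exists_rate_of_stripNu_lt hν
  obtain ⟨C, hC, h⟩ := exists_stripGFy_alpha_sub_le_geometric hT hy hθ hθ1
  refine ⟨stripGFy T 0 IsAlphaDart y + C, ?_⟩
  rintro _ ⟨L, rfl⟩
  have := h 0 L (Nat.zero_le L)
  have hθC : C * θ ^ (2 * 0 + 1) ≤ C := by
    rw [mul_zero, zero_add, pow_one]; exact mul_le_of_le_one_right hC.le hθ1.le
  linarith

/-- `ν_T(y) < x_c⁻¹ ⇒ (B_{T,L}(x_c;y))_L` is bounded (the tree's `mem_stripBddSet_of_stripNu_lt`, re-derived from the tail bound).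
[cite: BeatonBousquetMelouDeGierDuminilCopinGuttmann2014, Corollary 8 (arXiv v5 p. 12)] -/
theorem bddAbove_stripGFy_beta_of_stripNu_lt (hT : 1 ≤ T) {y : ℝ} (hy : 0 < y) (hν : stripNu T y < hexCriticalFugacity⁻¹) :
    BddAbove (Set.range fun L : ℕ => stripGFy T L (IsBetaDart T) y) := by
  obtain ⟨θ, hθ, hθ1⟩ := exists_rate_of_stripNu_lt hν
  obtain ⟨C, hC, h⟩ := exists_stripGFy_beta_sub_le_geometric hT hy hθ hθ1
  refine ⟨stripGFy T 0 (IsBetaDart T) y + C, ?_⟩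
  rintro _ ⟨L, rfl⟩
  have := h 0 L (Nat.zero_le L)
  have hθC : C * θ ^ (2 * 0 + 1) ≤ C := by
    rw [mul_zero, zero_add, pow_one]; exact mul_le_of_le_one_right hC.le hθ1.le
  linarith

/-- **Geometric convergence `A_{T,L}(x_c;y) → A_T(x_c;y)`**: if `x_c ν_T(y) < θ < 1` then
`0 ≤ A_T(x_c;y) − A_{T,L}(x_c;y) ≤ C θ^{2L+1}` for all `L` (`A_T = sup_L A_{T,L}`).
[cite: BeatonBousquetMelouDeGierDuminilCopinGuttmann2014, Corollary 8 and proof of Proposition 9 (arXiv v5 pp. 12, 14)] -/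
theorem exists_stripAyLim_sub_le_geometric (hT : 1 ≤ T) {y θ : ℝ} (hy : 0 < y)
    (hθ : hexCriticalFugacity * stripNu T y < θ) (hθ1 : θ < 1) :
    ∃ C : ℝ, 0 < C ∧ ∀ L : ℕ, 0 ≤ stripAyLim T y - stripGFy T L IsAlphaDart y ∧
      stripAyLim T y - stripGFy T L IsAlphaDart y ≤ C * θ ^ (2 * L + 1) := by
  have hx := hexCriticalFugacity_pos_lt_one.1
  have hν : stripNu T y < hexCriticalFugacity⁻¹ := by
    rw [lt_inv_comm₀ (stripNu_pos hT hy) hx]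
    have hθ0 : 0 < stripNu T y := stripNu_pos hT hy
    calc hexCriticalFugacity = hexCriticalFugacity * stripNu T y / stripNu T y := by field_simp
      _ < 1 / stripNu T y := by
          exact div_lt_div_of_pos_right (hθ.trans hθ1) hθ0
      _ = (stripNu T y)⁻¹ := one_div _
  have hbdd := bddAbove_stripGFy_alpha_of_stripNu_lt hT hy hν
  obtain ⟨C, hC, h⟩ := exists_stripGFy_alpha_sub_le_geometric hT hy hθ hθ1
  refine ⟨C, hC, fun L => ⟨sub_nonneg.2 (le_ciSup hbdd L), ?_⟩⟩
  rw [sub_le_iff_le_add, stripAyLim]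
  refine ciSup_le fun L' => ?_
  rcases le_total L L' with hLL' | hLL'
  · have := h L L' hLL'; linarith
  · have := stripGFy_alpha_mono_L (T := T) hLL' hy.le
    have : 0 ≤ C * θ ^ (2 * L + 1) := by
      have hθ0 : 0 ≤ θ := (mul_pos hx (stripNu_pos hT hy)).le.trans hθ.le
      positivity
    linarith

/-- **Geometric convergence `B_{T,L}(x_c;y) → B_T(x_c;y)`**: if `x_c ν_T(y) < θ < 1` then
`0 ≤ B_T(x_c;y) − B_{T,L}(x_c;y) ≤ C θ^{2L+1}` for all `L` (`B_T = sup_L B_{T,L}`).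
[cite: BeatonBousquetMelouDeGierDuminilCopinGuttmann2014, Corollary 8 and proof of Proposition 9 (arXiv v5 pp. 12, 14)] -/
theorem exists_stripByLim_sub_le_geometric (hT : 1 ≤ T) {y θ : ℝ} (hy : 0 < y)
    (hθ : hexCriticalFugacity * stripNu T y < θ) (hθ1 : θ < 1) :
    ∃ C : ℝ, 0 < C ∧ ∀ L : ℕ, 0 ≤ stripByLim T y - stripGFy T L (IsBetaDart T) y ∧
      stripByLim T y - stripGFy T L (IsBetaDart T) y ≤ C * θ ^ (2 * L + 1) := by
  have hx := hexCriticalFugacity_pos_lt_one.1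
  have hν : stripNu T y < hexCriticalFugacity⁻¹ := by
    rw [lt_inv_comm₀ (stripNu_pos hT hy) hx]
    have hθ0 : 0 < stripNu T y := stripNu_pos hT hy
    calc hexCriticalFugacity = hexCriticalFugacity * stripNu T y / stripNu T y := by field_simp
      _ < 1 / stripNu T y := by
          exact div_lt_div_of_pos_right (hθ.trans hθ1) hθ0
      _ = (stripNu T y)⁻¹ := one_div _
  have hbdd := bddAbove_stripGFy_beta_of_stripNu_lt hT hy hν
  obtain ⟨C, hC, h⟩ := exists_stripGFy_beta_sub_le_geometric hT hy hθ hθ1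
  refine ⟨C, hC, fun L => ⟨sub_nonneg.2 (le_ciSup hbdd L), ?_⟩⟩
  rw [sub_le_iff_le_add, stripByLim]
  refine ciSup_le fun L' => ?_
  rcases le_total L L' with hLL' | hLL'
  · have := h L L' hLL'; linarith
  · have := stripGFy_beta_mono_L (T := T) hLL' hy.le
    have : 0 ≤ C * θ ^ (2 * L + 1) := by
      have hθ0 : 0 ≤ θ := (mul_pos hx (stripNu_pos hT hy)).le.trans hθ.le
      positivity
    linarith

end Tails

end Literature.Probability.RandomPlanarGeometry.SAW.HV
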